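import Mathlib
import Summits.ValiantsHypothesis.ValiantsHypothesis.Theses.BinomialElusive

/-!
# `BinomialElusive.PeelingLemma` (stmt-ValiantsHypothesis-7391) is FALSE modulo the existence of
# relation-free all-X designs — a kernel reduction of the crux to finite combinatorics

`AllXDesignsExist → ¬ PeelingLemma` (`PeelingLemma_false_of_AllXDesignsExist`).

**The hypothesis `H = AllXDesignsExist` (pure combinatorics, no analysis, no `ℂ`).**  For every `m₀`
there is an `m ≥ m₀` and an *all-X design* of size `m`: integers `n + s = m - 1`, integer vectors
`ψ ψ' : Fin n → ℤ^s` ("binomial registers"), and for each of the `m` outputs `i` a pair of registers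
`(V i, W i)` and four letters `A i, B i, C i, D i : Fin s` with the PAIR-SUM identities
`ψ (V i) + ψ (W i) = e_{A i} + e_{B i}`, `ψ' (V i) + ψ' (W i) = e_{C i} + e_{D i}`, such that the `2m`
*output vectors* `o_{i,1} = ψ (V i) + ψ' (W i)`, `o_{i,2} = ψ' (V i) + ψ (W i)` admit NO nonzero
integer relation `Σ_i (u_i • o_{i,1} + v_i • o_{i,2}) = 0` of length `Σ_i (|u_i| + |v_i|) ≤ ⌊log₂ m⌋²`.

**The reduction (this file, sorry-free).**  Given such a design put `θ_μ = K^μ` (`K` larger than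
`⌊log₂ m⌋²` times the total mass of the output vectors), monomial registers `M_μ = t^{K^s + θ_μ}`,
binomial registers `B_v = t^{K^s + ⟨ψ v, θ⟩} + t^{K^s + ⟨ψ' v, θ⟩}` and the quadratic forms
`Γ_i = z_{V i} z_{W i} - z_{A i} z_{B i} - z_{C i} z_{D i}` (`totalDegree ≤ 2`).  The pair-sum
identities give `B_V B_W - M_A M_B - M_C M_D = t^{a_i} + t^{b_i}` EXACTLY (the identity
`(X+X')(Y+Y') - XY - X'Y' = XY' + X'Y`), with `a_i = 2K^s + ⟨o_{i,1}, θ⟩ ≥ 0`,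
`b_i = 2K^s + ⟨o_{i,2}, θ⟩ ≥ 0`; so the hypotheses of `PeelingLemma` hold at `m` with `N = 1`.  A
relation `Σ (u_i a_i + v_i b_i) = 0` of length `≤ ⌊log₂ m⌋²` reads
`2K^s Σ(u_i + v_i) + Σ_μ w_μ K^μ = 0` with `w = Σ (u_i • o_{i,1} + v_i • o_{i,2})` and all
`|w_μ| < K`, whence (`K`-adic uniqueness) `w = 0` — contradicting the design.  Hence `¬ PeelingLemma`.

**Relation to p1's exponent-level lemma.**  `Theorems/PeelingLemma/Negative/PeelingLemmaFalseOfAllXDesigns.lean`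
(`peelingLemma_false_of_allXDesigns`, val-width-7391-p1, p553410) proves `¬ PeelingLemma` from an
EXPONENT-level hypothesis (integer exponents `α, β` with planted coincidences and no short relation
among the cross sums).  The present file removes the number theory from what remains to be built:
its hypothesis `AllXDesignsExist` is VECTOR-level (integer vectors with the pair-sum identities and
no short relation among the output VECTORS), and the generic-weight step `θ_μ = K^μ` ("relations of
length `≤ ⌊log₂ m⌋²` among exponents = relations among vectors") is carried out here, sorry-free.
So a purely combinatorial construction of relation-free designs now suffices.

**Status of `H`.**  `H` is the "§3(ii)" target of `Cruxes/PeelingLemma/ALLX-MECHANISM.md` and of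
p1's paper sketch `Cruxes/PeelingLemma/ALLX-PROOF-SKETCH.md` (wide-FIFO designs on subdivided cubic
graphs, one probabilistic step).  The refuter's structural analysis (potential form of designs, the
end-label obstruction for designs with coinciding branch potentials, letter-slot counting of cheap
pieces; `Cruxes/PeelingLemma/Disproof.lean`) supports `H`, but no proof of `H` is in the tree: this
file is a NEGATIVE LEMMA MODULO `H`, not a refutation, and changes no verdict.  Valiant's hypothesis
`VP ≠ VNP` is not moved either way.
-/

-- layout Summits/ValiantsHypothesis/ValiantsHypothesis forces the duplicated namespace component
set_option linter.dupNamespace false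

namespace Summit.ValiantsHypothesis.ValiantsHypothesis.Theorems.PeelingLemmaNegative

open scoped BigOperators
open Finset

/-- **H — relation-free all-X designs exist at all large sizes** (finite combinatorics; see the
module docstring).  [topic Combinatorics.Designs] -/
def AllXDesignsExist : Prop :=
  ∀ m₀ : ℕ, ∃ m ≥ m₀, ∃ n s : ℕ, n + s = m - 1 ∧
    ∃ (ψ ψ' : Fin n → Fin s → ℤ) (V W : Fin m → Fin n) (A B C D : Fin m → Fin s),
      (∀ i, ψ (V i) + ψ (W i) = Pi.single (A i) 1 + Pi.single (B i) 1) ∧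
      (∀ i, ψ' (V i) + ψ' (W i) = Pi.single (C i) 1 + Pi.single (D i) 1) ∧
      ∀ u v : Fin m → ℤ, (u, v) ≠ 0 → ∑ i, (|u i| + |v i|) ≤ ((Nat.log 2 m ^ 2 : ℕ) : ℤ) →
        ∑ i, (u i • (ψ (V i) + ψ' (W i)) + v i • (ψ' (V i) + ψ (W i))) ≠ 0

/-! ## `K`-adic digits -/

/-- `|Σ_{μ<s} w_μ K^μ| ≤ K^s - 1` when all `|w_μ| ≤ K - 1`. -/
theorem abs_sum_mul_pow_le {s : ℕ} {K : ℤ} (hK : 1 ≤ K) (w : Fin s → ℤ)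
    (hw : ∀ μ, |w μ| ≤ K - 1) : |∑ μ : Fin s, w μ * K ^ (μ : ℕ)| ≤ K ^ s - 1 := by
  have hK0 : 0 ≤ K := by omega
  calc |∑ μ : Fin s, w μ * K ^ (μ : ℕ)| ≤ ∑ μ : Fin s, |w μ * K ^ (μ : ℕ)| :=
        abs_sum_le_sum_abs _ _
    _ ≤ ∑ μ : Fin s, (K - 1) * K ^ (μ : ℕ) := by
        refine sum_le_sum fun μ _ => ?_
        rw [abs_mul, abs_of_nonneg (pow_nonneg hK0 _)]
        exact mul_le_mul_of_nonneg_right (hw μ) (pow_nonneg hK0 _)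
    _ = (K - 1) * ∑ i ∈ range s, K ^ i := by
        rw [← mul_sum, Fin.sum_univ_eq_sum_range (fun i => K ^ i)]
    _ = K ^ s - 1 := by
        rw [mul_comm, geom_sum_mul]

/-- `K`-adic uniqueness: digits of absolute value `< K` with vanishing `K`-adic sum all vanish. -/
theorem eq_zero_of_sum_mul_pow_eq_zero {s : ℕ} {K : ℤ} (hK : 1 ≤ K) (w : Fin s → ℤ)
    (hw : ∀ μ, |w μ| ≤ K - 1) (h0 : ∑ μ : Fin s, w μ * K ^ (μ : ℕ) = 0) : w = 0 := by
  have hK0 : 0 ≤ K := by omega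
  induction s with
  | zero => exact funext fun μ => Fin.elim0 μ
  | succ s ih =>
    rw [Fin.sum_univ_castSucc] at h0
    simp only [Fin.val_castSucc, Fin.val_last] at h0
    have hlast : w (Fin.last s) = 0 := by
      by_contra hne
      have h1 : K ^ s ≤ |w (Fin.last s) * K ^ s| := by
        rw [abs_mul, abs_of_nonneg (pow_nonneg hK0 _)]
        exact le_mul_of_one_le_left (pow_nonneg hK0 _) (Int.one_le_abs hne)
      have h2 := abs_sum_mul_pow_le hK (fun μ : Fin s => w μ.castSucc) (fun μ => hw _)
      have h3 : ∑ μ : Fin s, w μ.castSucc * K ^ (μ : ℕ) = -(w (Fin.last s) * K ^ s) := by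
        linarith
      rw [h3, abs_neg] at h2
      linarith
    have hrest : (fun μ : Fin s => w μ.castSucc) = 0 := by
      apply ih (fun μ => w μ.castSucc) (fun μ => hw _)
      rw [hlast, zero_mul, add_zero] at h0
      exact h0
    funext μ
    cases μ using Fin.lastCases with
    | last => exact hlast
    | cast j => exact congr_fun hrest j

/-! ## The reduction -/

/-- **`PeelingLemma` is false modulo `AllXDesignsExist`.**  See the module docstring. -/
theorem PeelingLemma_false_of_AllXDesignsExist (hH : AllXDesignsExist) :
    ¬ Summit.ValiantsHypothesis.ValiantsHypothesis.Theses.BinomialElusive.PeelingLemma := by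
  classical
  rintro ⟨m₀, hPL⟩
  obtain ⟨m, hm, n, s, hns, ψ, ψ', V, W, A, B, C, D, hψ, hψ', hfree⟩ := hH m₀
  -- the output vectors and their total mass
  set o₁ : Fin m → Fin s → ℤ := fun i => ψ (V i) + ψ' (W i) with ho₁def
  set o₂ : Fin m → Fin s → ℤ := fun i => ψ' (V i) + ψ (W i) with ho₂def
  set L : ℤ := ∑ i, ∑ μ, (|o₁ i μ| + |o₂ i μ|) with hLdef
  have hL0 : 0 ≤ L := sum_nonneg fun i _ => sum_nonneg fun μ _ => by positivity
  have hoL : ∀ i μ, |o₁ i μ| ≤ L ∧ |o₂ i μ| ≤ L := by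
    intro i μ
    have h1 : |o₁ i μ| + |o₂ i μ| ≤ ∑ μ', (|o₁ i μ'| + |o₂ i μ'|) :=
      single_le_sum (f := fun μ' => |o₁ i μ'| + |o₂ i μ'|) (fun _ _ => by positivity) (mem_univ μ)
    have h2 : ∑ μ', (|o₁ i μ'| + |o₂ i μ'|) ≤ L :=
      single_le_sum (f := fun i' => ∑ μ', (|o₁ i' μ'| + |o₂ i' μ'|))
        (fun _ _ => sum_nonneg fun _ _ => by positivity) (mem_univ i)
    constructor <;> linarith [abs_nonneg (o₁ i μ), abs_nonneg (o₂ i μ)]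
  -- the base `K` and the weights `θ_μ = K^μ`, register shift `E = K^s`
  set hb : ℕ := Nat.log 2 m ^ 2 with hhb
  set K : ℤ := (hb : ℤ) * L + L + 2 with hKdef
  have hbL : (0 : ℤ) ≤ (hb : ℤ) * L := by positivity
  have hK1 : 1 ≤ K := by linarith
  have hK0 : 0 ≤ K := by linarith
  set E : ℤ := K ^ s with hEdef
  have hE1 : 1 ≤ E := one_le_pow₀ hK1
  -- exponents of the outputs
  set e₁ : Fin m → ℤ := fun i => 2 * E + ∑ μ, o₁ i μ * K ^ (μ : ℕ) with he₁def
  set e₂ : Fin m → ℤ := fun i => 2 * E + ∑ μ, o₂ i μ * K ^ (μ : ℕ) with he₂def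
  have hbnd₁ : ∀ i, |∑ μ, o₁ i μ * K ^ (μ : ℕ)| ≤ E - 1 := fun i =>
    abs_sum_mul_pow_le hK1 (o₁ i) fun μ => by linarith [(hoL i μ).1, hL0, hbL]
  have hbnd₂ : ∀ i, |∑ μ, o₂ i μ * K ^ (μ : ℕ)| ≤ E - 1 := fun i =>
    abs_sum_mul_pow_le hK1 (o₂ i) fun μ => by linarith [(hoL i μ).2, hL0, hbL]
  have he₁ : ∀ i, 0 ≤ e₁ i := fun i => by
    have := hbnd₁ i; rw [abs_le] at this; simp only [he₁def]; linarith
  have he₂ : ∀ i, 0 ≤ e₂ i := fun i => by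
    have := hbnd₂ i; rw [abs_le] at this; simp only [he₂def]; linarith
  let a : Fin m → ℕ := fun i => (e₁ i).toNat
  let b : Fin m → ℕ := fun i => (e₂ i).toNat
  have ha : ∀ i, (a i : ℤ) = e₁ i := fun i => Int.toNat_of_nonneg (he₁ i)
  have hb' : ∀ i, (b i : ℤ) = e₂ i := fun i => Int.toNat_of_nonneg (he₂ i)
  -- registers: `Fin (m-1) ≃ Fin n ⊕ Fin s`, binomials on the left, monomials on the right
  let ι : Fin n ⊕ Fin s ≃ Fin (m - 1) := finSumFinEquiv.trans (finCongr hns)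
  let X : Fin n → LaurentSeries ℂ := fun v =>
    HahnSeries.single (E + ∑ μ, ψ v μ * K ^ (μ : ℕ)) (1 : ℂ)
  let X' : Fin n → LaurentSeries ℂ := fun v =>
    HahnSeries.single (E + ∑ μ, ψ' v μ * K ^ (μ : ℕ)) (1 : ℂ)
  let M : Fin s → LaurentSeries ℂ := fun μ => HahnSeries.single (E + K ^ (μ : ℕ)) (1 : ℂ)
  let F : Fin n ⊕ Fin s → LaurentSeries ℂ := Sum.elim (fun v => X v + X' v) M
  let p : Fin (m - 1) → LaurentSeries ℂ := fun j => F (ι.symm j)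
  let Γ : Fin m → MvPolynomial (Fin (m - 1)) ℂ := fun i =>
    MvPolynomial.X (ι (Sum.inl (V i))) * MvPolynomial.X (ι (Sum.inl (W i)))
      - MvPolynomial.X (ι (Sum.inr (A i))) * MvPolynomial.X (ι (Sum.inr (B i)))
      - MvPolynomial.X (ι (Sum.inr (C i))) * MvPolynomial.X (ι (Sum.inr (D i)))
  have hXX : ∀ j k : Fin (m - 1),
      (MvPolynomial.X j * MvPolynomial.X k : MvPolynomial (Fin (m - 1)) ℂ).totalDegree ≤ 2 :=
    fun j k => (MvPolynomial.totalDegree_mul _ _).trans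
      (by rw [MvPolynomial.totalDegree_X, MvPolynomial.totalDegree_X])
  have hdeg : ∀ i, (Γ i).totalDegree ≤ 2 := fun i =>
    (MvPolynomial.totalDegree_sub _ _).trans (max_le ((MvPolynomial.totalDegree_sub _ _).trans
      (max_le (hXX _ _) (hXX _ _))) (hXX _ _))
  -- pair sums read on the weights
  have hpair : ∀ i, (∑ μ, ψ (V i) μ * K ^ (μ : ℕ)) + ∑ μ, ψ (W i) μ * K ^ (μ : ℕ)
      = K ^ (A i : ℕ) + K ^ (B i : ℕ) := by
    intro i
    rw [← sum_add_distrib]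
    have : ∀ μ, ψ (V i) μ * K ^ (μ : ℕ) + ψ (W i) μ * K ^ (μ : ℕ)
        = (Pi.single (A i) (1 : ℤ) + Pi.single (B i) (1 : ℤ) : Fin s → ℤ) μ * K ^ (μ : ℕ) := by
      intro μ; rw [← hψ i, Pi.add_apply, add_mul]
    simp only [this, Pi.add_apply, add_mul, sum_add_distrib, Pi.single_apply, ite_mul, one_mul,
      zero_mul, sum_ite_eq', mem_univ, if_true]
  have hpair' : ∀ i, (∑ μ, ψ' (V i) μ * K ^ (μ : ℕ)) + ∑ μ, ψ' (W i) μ * K ^ (μ : ℕ)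
      = K ^ (C i : ℕ) + K ^ (D i : ℕ) := by
    intro i
    rw [← sum_add_distrib]
    have : ∀ μ, ψ' (V i) μ * K ^ (μ : ℕ) + ψ' (W i) μ * K ^ (μ : ℕ)
        = (Pi.single (C i) (1 : ℤ) + Pi.single (D i) (1 : ℤ) : Fin s → ℤ) μ * K ^ (μ : ℕ) := by
      intro μ; rw [← hψ' i, Pi.add_apply, add_mul]
    simp only [this, Pi.add_apply, add_mul, sum_add_distrib, Pi.single_apply, ite_mul, one_mul,
      zero_mul, sum_ite_eq', mem_univ, if_true]
  have hsum₁ : ∀ i, (∑ μ, ψ (V i) μ * K ^ (μ : ℕ)) + ∑ μ, ψ' (W i) μ * K ^ (μ : ℕ)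
      = ∑ μ, o₁ i μ * K ^ (μ : ℕ) := by
    intro i; rw [← sum_add_distrib]; refine sum_congr rfl fun μ _ => ?_
    simp only [ho₁def, Pi.add_apply, add_mul]
  have hsum₂ : ∀ i, (∑ μ, ψ' (V i) μ * K ^ (μ : ℕ)) + ∑ μ, ψ (W i) μ * K ^ (μ : ℕ)
      = ∑ μ, o₂ i μ * K ^ (μ : ℕ) := by
    intro i; rw [← sum_add_distrib]; refine sum_congr rfl fun μ _ => ?_
    simp only [ho₂def, Pi.add_apply, add_mul]
  -- the outputs of the design: `Γ_i(p) = t^{a_i} + t^{b_i}` exactly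
  have heval : ∀ i, MvPolynomial.aeval p (Γ i) = HahnSeries.single ((1 * a i : ℕ) : ℤ) (1 : ℂ)
      + HahnSeries.single ((1 * b i : ℕ) : ℤ) (1 : ℂ) := by
    intro i
    have hev : MvPolynomial.aeval p (Γ i)
        = (X (V i) + X' (V i)) * (X (W i) + X' (W i)) - M (A i) * M (B i) - M (C i) * M (D i) := by
      simp only [Γ, map_sub, map_mul, MvPolynomial.aeval_X, p, Equiv.symm_apply_apply, F,
        Sum.elim_inl, Sum.elim_inr]
    have hMM : M (A i) * M (B i) = X (V i) * X (W i) := by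
      have hexp : E + K ^ (A i : ℕ) + (E + K ^ (B i : ℕ))
          = E + ∑ μ, ψ (V i) μ * K ^ (μ : ℕ) + (E + ∑ μ, ψ (W i) μ * K ^ (μ : ℕ)) := by
        linarith [hpair i]
      simp only [M, X, HahnSeries.single_mul_single, mul_one, hexp]
    have hMM' : M (C i) * M (D i) = X' (V i) * X' (W i) := by
      have hexp : E + K ^ (C i : ℕ) + (E + K ^ (D i : ℕ))
          = E + ∑ μ, ψ' (V i) μ * K ^ (μ : ℕ) + (E + ∑ μ, ψ' (W i) μ * K ^ (μ : ℕ)) := by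
        linarith [hpair' i]
      simp only [M, X', HahnSeries.single_mul_single, mul_one, hexp]
    rw [hev, hMM, hMM', one_mul, one_mul, ha, hb']
    have hring : (X (V i) + X' (V i)) * (X (W i) + X' (W i)) - X (V i) * X (W i)
        - X' (V i) * X' (W i) = X (V i) * X' (W i) + X' (V i) * X (W i) := by ring
    rw [hring]
    have hx₁ : E + ∑ μ, ψ (V i) μ * K ^ (μ : ℕ) + (E + ∑ μ, ψ' (W i) μ * K ^ (μ : ℕ)) = e₁ i := by
      simp only [he₁def]; linarith [hsum₁ i]
    have hx₂ : E + ∑ μ, ψ' (V i) μ * K ^ (μ : ℕ) + (E + ∑ μ, ψ (W i) μ * K ^ (μ : ℕ)) = e₂ i := by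
      simp only [he₂def]; linarith [hsum₂ i]
    simp only [X, X', HahnSeries.single_mul_single, mul_one, hx₁, hx₂]
  -- apply the peeling lemma to the design's instance and transfer the relation
  obtain ⟨u, v, huv, hcost, hrel⟩ := hPL m hm a b Γ 1 p hdeg one_pos heval
  set S : ℤ := ∑ i, (u i + v i) with hSdef
  set w : Fin s → ℤ := fun μ => ∑ i, (u i * o₁ i μ + v i * o₂ i μ) with hwdef
  have per : ∀ i, u i * (a i : ℤ) + v i * (b i : ℤ)
      = 2 * E * (u i + v i) + ∑ μ, (u i * o₁ i μ + v i * o₂ i μ) * K ^ (μ : ℕ) := by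
    intro i
    rw [ha, hb']
    simp only [he₁def, he₂def, add_mul, sum_add_distrib, mul_assoc, ← mul_sum]
    ring
  have key : ∑ i, (u i * (a i : ℤ) + v i * (b i : ℤ)) = 2 * E * S + ∑ μ, w μ * K ^ (μ : ℕ) := by
    rw [sum_congr rfl fun i _ => per i, sum_add_distrib, ← mul_sum, sum_comm]
    simp only [hSdef, hwdef, sum_mul]
  rw [key] at hrel
  -- digit bounds
  have hcostabs : ∀ i, |u i| ≤ (hb : ℤ) ∧ |v i| ≤ (hb : ℤ) := by
    intro i
    have h1 : |u i| + |v i| ≤ ∑ j, (|u j| + |v j|) :=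
      single_le_sum (f := fun j => |u j| + |v j|) (fun _ _ => by positivity) (mem_univ i)
    constructor <;> linarith [abs_nonneg (u i), abs_nonneg (v i), hcost]
  have hw : ∀ μ, |w μ| ≤ K - 1 := by
    intro μ
    have h1 : |w μ| ≤ ∑ i, (|u i| + |v i|) * L := by
      calc |w μ| ≤ ∑ i, |u i * o₁ i μ + v i * o₂ i μ| := abs_sum_le_sum_abs _ _
        _ ≤ ∑ i, (|u i| + |v i|) * L := sum_le_sum fun i _ => by
            calc |u i * o₁ i μ + v i * o₂ i μ| ≤ |u i * o₁ i μ| + |v i * o₂ i μ| := abs_add_le _ _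
              _ = |u i| * |o₁ i μ| + |v i| * |o₂ i μ| := by rw [abs_mul, abs_mul]
              _ ≤ |u i| * L + |v i| * L := add_le_add
                  (mul_le_mul_of_nonneg_left (hoL i μ).1 (abs_nonneg _))
                  (mul_le_mul_of_nonneg_left (hoL i μ).2 (abs_nonneg _))
              _ = (|u i| + |v i|) * L := by ring
    rw [← sum_mul] at h1
    have h2 : (∑ i, (|u i| + |v i|)) * L ≤ (hb : ℤ) * L := mul_le_mul_of_nonneg_right hcost hL0
    linarith
  have hwK : |∑ μ, w μ * K ^ (μ : ℕ)| ≤ E - 1 := abs_sum_mul_pow_le hK1 w hw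
  have hS : S = 0 := by
    by_contra hS
    have h1 : 2 * E ≤ |2 * E * S| := by
      rw [abs_mul, abs_of_nonneg (by linarith : (0 : ℤ) ≤ 2 * E)]
      exact le_mul_of_one_le_right (by linarith) (Int.one_le_abs hS)
    have h2 : 2 * E * S = -∑ μ, w μ * K ^ (μ : ℕ) := by linarith
    rw [h2, abs_neg] at h1
    linarith
  rw [hS, mul_zero, zero_add] at hrel
  have hw0 : w = 0 := eq_zero_of_sum_mul_pow_eq_zero hK1 w hw hrel
  refine hfree u v huv hcost ?_
  funext μ
  have := congr_fun hw0 μ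
  simp only [hwdef, ho₁def, ho₂def, Pi.zero_apply, Pi.add_apply] at this
  simp only [Finset.sum_apply, Pi.add_apply, Pi.smul_apply, smul_eq_mul, Pi.zero_apply]
  exact this

end Summit.ValiantsHypothesis.ValiantsHypothesis.Theorems.PeelingLemmaNegative
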